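import Mathlib.Analysis.SpecialFunctions.Pow.Real
import Mathlib.Analysis.SpecialFunctions.Sqrt
import HarnessLib

/-!
# The pred-slot budget with a raised up bond, at most two contacts: zone lemmas in cubic coordinates

HONEST FRAMING. Part of the venture `Summits/Ventures/Crystal3D` (cell `crystal3d-full`), helper
`--supports` the crux `NoReconstructionGain` (stmt-Ventures-19144, route
`route-Ventures-StickyWulffConstant`), line `adhesion` (wulff-p1 g14).  Pure real-variable bricks for the
brick B1b `predSlotBudget_of_upBond_raised` of skeleton v20 (the pred-slot budget of g13 when one up bond
of the grain is `ν`-raised), in the cubic coordinates of `…GrainFrameBudgetThree`: pulled-back normal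
`n = (a, b, c)` (`a² + b² + c² = 2`, axis condition `−a + b + c ≥ √(2/3)`), raised bond `W₃ = (−1,1,0)`
(`b ≤ a`), mirror-normalised `a + b ≥ 0` ("region R"); contacts `(x, y, z)` with `x² + y² + z² = 2`, depth
`a x + b y + c z ≥ T`, pairwise `x x' + y y' + z z' ≤ 1`.  The four STEEP slots `B₂ = (1,0,1)`,
`W₁ = (0,1,1)`, `B₃ = (0,−1,1)`, `W₂ = (−1,0,1)` are `ν`-below (depths `a + c`, `b + c`, `c − b`, `c − a`);
`regionR_bounds`, `steep_cover` (positive height blocks a steep slot), `flat_depth_le` (height `≤ 0` is at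
most `c + |b|` deep), `zone_one_le` / `zone_pair_gt_one` (one-slot zones and their pair exclusion),
`depth_le_of_P/M/Q_level/B3zone` (zone depth caps), `extreme_two_of_three` (the twin point `a = b = c`),
and THE BUDGET FOR ONE AND FOR TWO CONTACTS `raisedBudget_one`, `raisedBudget_two` with abstract credit
propositions fed by the coordinate blocking / submersion conditions (the hex slots only when their pair is
not level).  WHAT THIS IS NOT: three contacts (brick B1b₃); the frame-level statement (companion file);
rung F-C1 not moved.
-/

namespace Summit.Ventures.Crystal3D.Theorems

/-! ### Region R -/

/-- Basic bounds in region R: `0 ≤ a`, `−a ≤ b`, `3a² ≤ 2`, `a ≤ √(2/3) ≤ c`, `a ≤ c`. -/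
theorem regionR_bounds {a b c : ℝ} (hn : a ^ 2 + b ^ 2 + c ^ 2 = 2)
    (hs : Real.sqrt (2 / 3) ≤ -a + b + c) (hba : b ≤ a) (hab : 0 ≤ a + b) :
    0 ≤ a ∧ -a ≤ b ∧ 3 * a ^ 2 ≤ 2 ∧ a ≤ Real.sqrt (2 / 3) ∧ Real.sqrt (2 / 3) ≤ c ∧ a ≤ c := by
  have h23 : Real.sqrt (2 / 3) ^ 2 = 2 / 3 := Real.sq_sqrt (by norm_num)
  have hpos : 0 < Real.sqrt (2 / 3) := Real.sqrt_pos.2 (by norm_num)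
  have ha : 0 ≤ a := by linarith
  obtain ⟨hc, hc0⟩ : Real.sqrt (2 / 3) + (a - b) ≤ c ∧ 0 ≤ Real.sqrt (2 / 3) + (a - b) := ⟨by linarith, by linarith⟩
  have hc2 : (Real.sqrt (2 / 3) + (a - b)) ^ 2 ≤ c ^ 2 := pow_le_pow_left₀ hc0 hc 2
  have key : (3 * a + 5 * Real.sqrt (2 / 3)) * (a - Real.sqrt (2 / 3)) ≤ 0 := by
    nlinarith [sq_nonneg (b - (a + Real.sqrt (2 / 3)) / 2)]
  have ha' : a ≤ Real.sqrt (2 / 3) := by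
    by_contra h
    push Not at h
    have : 0 < (3 * a + 5 * Real.sqrt (2 / 3)) * (a - Real.sqrt (2 / 3)) :=
      mul_pos (by linarith) (by linarith)
    linarith
  refine ⟨ha, by linarith, by nlinarith, ha', by linarith, by linarith⟩

/-! ### Zones of one contact -/

/-- **Steep cover.**  A contact of positive cubic height blocks one of the four steep slots. -/
theorem steep_cover {x y z : ℝ} (hu : x ^ 2 + y ^ 2 + z ^ 2 = 2) (hz : 0 < z) :
    1 < x + z ∨ 1 < z - x ∨ 1 < y + z ∨ 1 < z - y := by
  by_contra h
  push Not at h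
  obtain ⟨h1, h2, h3, h4⟩ := h
  have hz1 : z ≤ 1 := by nlinarith
  have hx : x ^ 2 ≤ (1 - z) ^ 2 := by nlinarith
  have hy : y ^ 2 ≤ (1 - z) ^ 2 := by nlinarith
  nlinarith

/-- **Flat contacts are shallow.**  A contact of height `≤ 0` has depth `≤ c + |b|` (region R). -/
theorem flat_depth_le {a b c x y z : ℝ} (hn : a ^ 2 + b ^ 2 + c ^ 2 = 2)
    (hs : Real.sqrt (2 / 3) ≤ -a + b + c) (hba : b ≤ a) (hab : 0 ≤ a + b)
    (hu : x ^ 2 + y ^ 2 + z ^ 2 = 2) (hz : z ≤ 0) : a * x + b * y + c * z ≤ c + |b| := by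
  obtain ⟨ha, hab', h3a, -, hs0c, hac⟩ := regionR_bounds hn hs hba hab
  have hpos : 0 < Real.sqrt (2 / 3) := Real.sqrt_pos.2 (by norm_num)
  have hc : 0 < c := by linarith
  have hcz : c * z ≤ 0 := mul_nonpos_of_nonneg_of_nonpos hc.le hz
  have hbabs : |b| ≤ c := by
    rw [abs_le]; constructor <;> linarith
  have h0 : 0 ≤ c + |b| := by positivity
  have hCS : (a * x + b * y) ^ 2 ≤ (a ^ 2 + b ^ 2) * (x ^ 2 + y ^ 2) := by
    nlinarith [sq_nonneg (a * y - b * x)]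
  have hxy : x ^ 2 + y ^ 2 ≤ 2 := by nlinarith
  have hb2 : b ^ 2 = |b| ^ 2 := (sq_abs b).symm
  have h2 : 2 * (a ^ 2 + b ^ 2) ≤ (c + |b|) ^ 2 := by
    nlinarith [mul_nonneg (abs_nonneg b) (sub_nonneg.2 hbabs)]
  have h3 : (a * x + b * y) ^ 2 ≤ (c + |b|) ^ 2 := by
    calc (a * x + b * y) ^ 2 ≤ (a ^ 2 + b ^ 2) * (x ^ 2 + y ^ 2) := hCS
      _ ≤ (a ^ 2 + b ^ 2) * 2 := by nlinarith
      _ ≤ (c + |b|) ^ 2 := by linarith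
  have h4 : a * x + b * y ≤ c + |b| := (abs_le_of_sq_le_sq' h3 h0).2
  linarith

/-- **Zone lemma.**  A contact that blocks `B₂` (`x + z > 1`) but neither `W₁` (`y + z ≤ 1`) nor `B₃`
(`z − y ≤ 1`) has `x ≥ 1`.  (Mirror images: `W₁`-only forces `y ≥ 1`, `W₂`-only `x ≤ −1`, `B₃`-only
`y ≤ −1` — apply with permuted / negated coordinates.) -/
theorem zone_one_le {x y z : ℝ} (hu : x ^ 2 + y ^ 2 + z ^ 2 = 2) (h1 : 1 < x + z) (h2 : y + z ≤ 1)
    (h3 : z - y ≤ 1) : 1 ≤ x := by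
  have hz1 : z ≤ 1 := by linarith
  have hy : y ^ 2 ≤ (1 - z) ^ 2 := by nlinarith
  rcases le_or_gt z 0 with hz | hz
  · linarith
  · -- `x² ≥ 2 − (1−z)² − z² = 1 + 2 z (1 − z) ≥ 1` and `x > 1 − z ≥ 0`
    have hx0 : 0 ≤ x := by linarith
    nlinarith [mul_nonneg hz.le (sub_nonneg.2 hz1)]

/-- **Pair exclusion.**  Two contacts in the `B₂`-zone (`x + z > 1`, `|y| ≤ 1 − z`, hence `x ≥ 1`) on the
same side (`y y' ≥ 0`) are strictly less than `60°` apart. -/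
theorem zone_pair_gt_one {x y z x' y' z' : ℝ} (hu : x ^ 2 + y ^ 2 + z ^ 2 = 2)
    (hu' : x' ^ 2 + y' ^ 2 + z' ^ 2 = 2) (h1 : 1 < x + z) (h2 : y + z ≤ 1) (h3 : z - y ≤ 1)
    (h1' : 1 < x' + z') (h2' : y' + z' ≤ 1) (h3' : z' - y' ≤ 1) (hyy : 0 ≤ y * y') :
    1 < x * x' + y * y' + z * z' := by
  have hx := zone_one_le hu h1 h2 h3
  have hx' := zone_one_le hu' h1' h2' h3'
  have hz1 : z ≤ 1 := by linarith
  have hz1' : z' ≤ 1 := by linarith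
  rcases le_or_gt z 0 with hz | hz
  · -- `x > 1 − z ≥ 1`: `x x' ≥ x > 1 − z`, and `z z' ≥ z` (`z ≤ 0`, `z' ≤ 1`)
    have e1 : x * 1 ≤ x * x' := mul_le_mul_of_nonneg_left hx' (by linarith)
    nlinarith [mul_nonneg (sub_nonneg.2 hz1') (by linarith : (0 : ℝ) ≤ -z)]
  · rcases le_or_gt z' 0 with hz' | hz'
    · have e1 : 1 * x' ≤ x * x' := mul_le_mul_of_nonneg_right hx (by linarith)
      nlinarith [mul_nonneg (sub_nonneg.2 hz1) (by linarith : (0 : ℝ) ≤ -z')]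
    · have e1 : (1 : ℝ) * 1 ≤ x * x' := mul_le_mul hx hx' zero_le_one (by linarith)
      nlinarith [mul_pos hz hz']

/-- Depth cap of the `B₂`-zone on the non-positive side: `x² + z² ≤ 2`, `z ≤ 1`, `0 ≤ a ≤ c` give
`a x + c z ≤ a + c`. -/
theorem depth_le_of_P {a c x z : ℝ} (hxz : x ^ 2 + z ^ 2 ≤ 2) (hz : z ≤ 1) (ha : 0 ≤ a) (hac : a ≤ c) :
    a * x + c * z ≤ a + c := by
  rcases le_or_gt x 1 with hx | hx
  · nlinarith [mul_nonneg ha (sub_nonneg.2 hx), mul_nonneg (ha.trans hac) (sub_nonneg.2 hz)]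
  · -- `x > 1`: `z² < 1`, so `z < 1`; `a(1−x) + c(1−z) ≥ a (2 − x − z) ≥ 0`
    have hz2 : z < 1 := by nlinarith
    have hsum : x + z ≤ 2 := by nlinarith [sq_nonneg (x - z)]
    nlinarith [mul_nonneg (sub_nonneg.2 hac) (sub_nonneg.2 hz2.le), mul_nonneg ha (by linarith : 0 ≤ 2 - x - z)]

/-- Depth cap of the `W₂`-zone (`x ≤ −1`, `|y| ≤ 1 − z`): depth `≤ c − a` (region R: `0 ≤ a`,
`|b| ≤ c`). -/
theorem depth_le_of_M {a b c x y z : ℝ} (ha : 0 ≤ a) (hbc : |b| ≤ c) (hx : x ≤ -1) (h2 : y + z ≤ 1)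
    (h3 : z - y ≤ 1) : a * x + b * y + c * z ≤ c - a := by
  have hz : z ≤ 1 := by linarith
  have hy : |y| ≤ 1 - z := abs_le.2 ⟨by linarith, by linarith⟩
  have hby : b * y ≤ |b| * (1 - z) := by
    calc b * y ≤ |b * y| := le_abs_self _
      _ = |b| * |y| := abs_mul b y
      _ ≤ |b| * (1 - z) := mul_le_mul_of_nonneg_left hy (abs_nonneg b)
  nlinarith [mul_nonneg (sub_nonneg.2 hbc) (sub_nonneg.2 hz), abs_nonneg b]

/-- Depth cap of the `W₁`-zone (`y ≥ 1`, `|x| ≤ 1 − z`) at a LEVEL hex pair `b = −a`: depth `≤ c − a`. -/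
theorem depth_le_of_Q_level {a c x y z : ℝ} (ha : 0 ≤ a) (hac : a ≤ c) (hy : 1 ≤ y) (h2 : x + z ≤ 1)
    (h3 : z - x ≤ 1) : a * x + -a * y + c * z ≤ c - a := by
  have hz : z ≤ 1 := by linarith
  nlinarith [mul_nonneg ha (by linarith : 0 ≤ 1 - z - x), mul_nonneg ha (sub_nonneg.2 hy),
    mul_nonneg (sub_nonneg.2 hac) (sub_nonneg.2 hz)]

/-- Depth cap of the `B₃`-zone (`z − y > 1`, `|x| ≤ 1 − z`): depth `≤ c + |b|` (region R). -/
theorem depth_le_of_B3zone {a b c x y z : ℝ} (hn : a ^ 2 + b ^ 2 + c ^ 2 = 2)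
    (hs : Real.sqrt (2 / 3) ≤ -a + b + c) (hba : b ≤ a) (hab : 0 ≤ a + b)
    (hu : x ^ 2 + y ^ 2 + z ^ 2 = 2) (h1 : 1 < z - y) (h2 : x + z ≤ 1) (h3 : z - x ≤ 1) :
    a * x + b * y + c * z ≤ c + |b| := by
  obtain ⟨ha, hab', -, -, hs0c, hac⟩ := regionR_bounds hn hs hba hab
  have hpos : 0 < Real.sqrt (2 / 3) := Real.sqrt_pos.2 (by norm_num)
  have hy1 : y ≤ -1 := by
    have := zone_one_le (x := -y) (y := x) (z := z) (by nlinarith) (by linarith) h2 h3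
    linarith
  have hz : z ≤ 1 := by linarith
  have hax : a * x ≤ a * (1 - z) := mul_le_mul_of_nonneg_left (by linarith) ha
  rcases le_or_gt 0 b with hb | hb
  · -- `b ≥ 0`: `b y ≤ −b`, and `a (1 − z) + c z ≤ c`
    rw [abs_of_nonneg hb]
    nlinarith [mul_nonneg hb (by linarith : 0 ≤ -y - 1), mul_nonneg (sub_nonneg.2 hac) (sub_nonneg.2 hz)]
  · -- `b < 0`: `|y| − 1 ≤ (y² − 1)/2 ≤ (1 − z²)/2`, and `c − a − |b| ≥ √(2/3) > 0`
    rw [abs_of_neg hb]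
    have hyy : -y - 1 ≤ (1 - z) * (1 + z) / 2 := by nlinarith [sq_nonneg (y + 1)]
    have hgap : 0 ≤ c - a + b := by linarith
    nlinarith [mul_nonneg hgap (sub_nonneg.2 hz), mul_nonneg (neg_nonneg.2 hb.le) (sub_nonneg.2 hz),
      mul_nonneg (neg_nonneg.2 hb.le) (by nlinarith : 0 ≤ (1 - z) * (1 - z))]

/-! ### The extreme point `a = b = c` (the twin orientation: `ν` along a `⟨111⟩` of the grain) -/

/-- At the extreme point a contact deeper than `2c` blocks two of the three deep slots `B₁, B₂, W₁`:
`(x+y) + (x+z) + (y+z) = 2(x+y+z) > 4` and each pair sum is `≤ 2`. -/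
theorem extreme_two_of_three {c T x y z : ℝ} (hc : 0 < c) (hu : x ^ 2 + y ^ 2 + z ^ 2 = 2)
    (hd : T ≤ c * x + c * y + c * z) (hT : 2 * c < T) :
    (1 < x + y ∧ 1 < x + z) ∨ (1 < x + y ∧ 1 < y + z) ∨ (1 < x + z ∧ 1 < y + z) := by
  have hsum : 2 < x + y + z := by
    by_contra h; push Not at h
    have : c * x + c * y + c * z ≤ 2 * c := by nlinarith
    linarith
  obtain ⟨e1, e2⟩ : x + y ≤ 2 ∧ x + z ≤ 2 :=
    ⟨by nlinarith [sq_nonneg (x - y), sq_nonneg z], by nlinarith [sq_nonneg (x - z), sq_nonneg y]⟩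
  have e3 : y + z ≤ 2 := by nlinarith [sq_nonneg (y - z), sq_nonneg x]
  by_cases h1 : 1 < x + y
  · by_cases h2 : 1 < x + z
    · exact Or.inl ⟨h1, h2⟩
    · exact Or.inr (Or.inl ⟨h1, by linarith⟩)
  · exact Or.inr (Or.inr ⟨by linarith, by linarith⟩)

/-! ### The budget in region R for one and for two contacts -/

/-- **One contact** (region R, mirror-normalised): it is credited by `B₂` submerged, or — if deeper than
`B₂` — it has positive height and blocks a steep slot; at the extreme point `b = c` (where `B₃` is level
and not fed) the deep slots `B₁, B₂, W₁` serve. -/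
theorem raisedBudget_one {a b c T x y z : ℝ} (hn : a ^ 2 + b ^ 2 + c ^ 2 = 2)
    (hs : Real.sqrt (2 / 3) ≤ -a + b + c) (hba : b ≤ a) (hab : 0 ≤ a + b)
    (hu : x ^ 2 + y ^ 2 + z ^ 2 = 2) (hd : T ≤ a * x + b * y + c * z)
    (PB1 PB2 PB3 PW1 PW2 PW3 : Prop) [Decidable PB1] [Decidable PB2] [Decidable PB3] [Decidable PW1]
    [Decidable PW2] [Decidable PW3]
    (hB1 : 0 < a + b → (1 < x + y ∨ T ≤ a + b) → PB1)
    (hB2 : 0 < a + c → (1 < x + z ∨ T ≤ a + c) → PB2) (hB3 : b < c → (1 < z - y ∨ T ≤ c - b) → PB3)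
    (hW1 : (1 < y + z ∨ T ≤ b + c) → PW1) (hW2 : (1 < z - x ∨ T ≤ c - a) → PW2) :
    (1 : ℝ) ≤ (if PB1 then (1 : ℝ) else 0) + (if PB2 then (1 : ℝ) else 0) + (if PB3 then (1 : ℝ) else 0) + (if PW1 then (1 : ℝ) else 0) + (if PW2 then (1 : ℝ) else 0) + (if PW3 then (1 : ℝ) else 0) := by
  obtain ⟨ha, hab', -, ha', hs0c, hac⟩ := regionR_bounds hn hs hba hab
  have hpos : 0 < Real.sqrt (2 / 3) := Real.sqrt_pos.2 (by norm_num)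
  have hac0 : 0 < a + c := by linarith
  have n1 : (0 : ℝ) ≤ (if PB1 then (1 : ℝ) else 0) := by split_ifs <;> norm_num
  have n2 : (0 : ℝ) ≤ (if PB2 then (1 : ℝ) else 0) := by split_ifs <;> norm_num
  have n3 : (0 : ℝ) ≤ (if PB3 then (1 : ℝ) else 0) := by split_ifs <;> norm_num
  have n4 : (0 : ℝ) ≤ (if PW1 then (1 : ℝ) else 0) := by split_ifs <;> norm_num
  have n5 : (0 : ℝ) ≤ (if PW2 then (1 : ℝ) else 0) := by split_ifs <;> norm_num
  have n6 : (0 : ℝ) ≤ (if PW3 then (1 : ℝ) else 0) := by split_ifs <;> norm_num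
  by_cases hTc : T ≤ a + c
  · rw [if_pos (hB2 hac0 (Or.inr hTc))]; linarith only [n1, n3, n4, n5, n6]
  push Not at hTc
  rcases lt_or_eq_of_le (hba.trans hac) with hbc | hbc
  · have hbabs : |b| ≤ a := abs_le.2 ⟨by linarith, hba⟩
    have hz : 0 < z := by
      by_contra hz; push Not at hz
      linarith [flat_depth_le hn hs hba hab hu hz]
    rcases steep_cover hu hz with h | h | h | h
    · rw [if_pos (hB2 hac0 (Or.inl h))]; linarith only [n1, n3, n4, n5, n6]
    · rw [if_pos (hW2 (Or.inl h))]; linarith only [n1, n2, n3, n4, n6]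
    · rw [if_pos (hW1 (Or.inl h))]; linarith only [n1, n2, n3, n5, n6]
    · rw [if_pos (hB3 hbc (Or.inl h))]; linarith only [n1, n2, n4, n5, n6]
  · -- extreme point `a = b = c`
    have hb : b = c := hbc
    have haa : a = c := le_antisymm hac (hb ▸ hba)
    subst hb; subst haa
    rcases extreme_two_of_three (by linarith) hu hd (by linarith) with ⟨h1, -⟩ | ⟨h1, -⟩ | ⟨h2, -⟩
    · rw [if_pos (hB1 (by linarith) (Or.inl h1))]; linarith only [n2, n3, n4, n5, n6]
    · rw [if_pos (hB1 (by linarith) (Or.inl h1))]; linarith only [n2, n3, n4, n5, n6]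
    · rw [if_pos (hB2 hac0 (Or.inl h2))]; linarith only [n1, n3, n4, n5, n6]

set_option maxHeartbeats 800000 in
/-- **Two contacts** (region R).  Up to depth `c + |b|` two steep slots are submerged; beyond it both
contacts have positive height and block steep slots — distinct ones, or else they share a one-slot zone,
which the pair-exclusion and depth-cap lemmas forbid (the flat slot `B₁` rescues the same-side pairs). -/
theorem raisedBudget_two {a b c T x₁ y₁ z₁ x₂ y₂ z₂ : ℝ} (hn : a ^ 2 + b ^ 2 + c ^ 2 = 2)
    (hs : Real.sqrt (2 / 3) ≤ -a + b + c) (hba : b ≤ a) (hab : 0 ≤ a + b)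
    (hu₁ : x₁ ^ 2 + y₁ ^ 2 + z₁ ^ 2 = 2) (hd₁ : T ≤ a * x₁ + b * y₁ + c * z₁)
    (hu₂ : x₂ ^ 2 + y₂ ^ 2 + z₂ ^ 2 = 2) (hd₂ : T ≤ a * x₂ + b * y₂ + c * z₂)
    (h12 : x₁ * x₂ + y₁ * y₂ + z₁ * z₂ ≤ 1)
    (PB1 PB2 PB3 PW1 PW2 PW3 : Prop) [Decidable PB1] [Decidable PB2] [Decidable PB3] [Decidable PW1]
    [Decidable PW2] [Decidable PW3]
    (hB1 : 0 < a + b → (1 < x₁ + y₁ ∨ 1 < x₂ + y₂ ∨ T ≤ a + b) → PB1)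
    (hB2 : 0 < a + c → (1 < x₁ + z₁ ∨ 1 < x₂ + z₂ ∨ T ≤ a + c) → PB2)
    (hB3 : b < c → (1 < z₁ - y₁ ∨ 1 < z₂ - y₂ ∨ T ≤ c - b) → PB3)
    (hW1 : (1 < y₁ + z₁ ∨ 1 < y₂ + z₂ ∨ T ≤ b + c) → PW1)
    (hW2 : (1 < z₁ - x₁ ∨ 1 < z₂ - x₂ ∨ T ≤ c - a) → PW2) :
    (2 : ℝ) ≤ (if PB1 then (1 : ℝ) else 0) + (if PB2 then (1 : ℝ) else 0) + (if PB3 then (1 : ℝ) else 0) + (if PW1 then (1 : ℝ) else 0) + (if PW2 then (1 : ℝ) else 0) + (if PW3 then (1 : ℝ) else 0) := by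
  obtain ⟨ha, hab', -, -, hs0c, hac⟩ := regionR_bounds hn hs hba hab
  have hpos : 0 < Real.sqrt (2 / 3) := Real.sqrt_pos.2 (by norm_num)
  have hac0 : 0 < a + c := by linarith
  have n1 : (0 : ℝ) ≤ (if PB1 then (1 : ℝ) else 0) := by split_ifs <;> norm_num
  have n2 : (0 : ℝ) ≤ (if PB2 then (1 : ℝ) else 0) := by split_ifs <;> norm_num
  have n3 : (0 : ℝ) ≤ (if PB3 then (1 : ℝ) else 0) := by split_ifs <;> norm_num
  have n4 : (0 : ℝ) ≤ (if PW1 then (1 : ℝ) else 0) := by split_ifs <;> norm_num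
  have n5 : (0 : ℝ) ≤ (if PW2 then (1 : ℝ) else 0) := by split_ifs <;> norm_num
  have n6 : (0 : ℝ) ≤ (if PW3 then (1 : ℝ) else 0) := by split_ifs <;> norm_num
  rcases lt_or_eq_of_le (hba.trans hac) with hbltc | hbeqc
  swap
  · -- extreme point `a = b = c`: the deep slots `B₁, B₂, W₁` (all of depth `2c`) serve
    have hb : b = c := hbeqc
    have haa : a = c := le_antisymm hac (hb ▸ hba)
    subst hb; subst haa
    by_cases hT2 : T ≤ a + a
    · rw [if_pos (hB1 (by linarith) (Or.inr (Or.inr hT2))), if_pos (hB2 hac0 (Or.inr (Or.inr hT2)))]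
      linarith only [n3, n4, n5, n6]
    · push Not at hT2
      rcases extreme_two_of_three (by linarith) hu₁ hd₁ (by linarith) with ⟨h1, h2⟩ | ⟨h1, h2⟩ | ⟨h1, h2⟩
      · rw [if_pos (hB1 (by linarith) (Or.inl h1)), if_pos (hB2 hac0 (Or.inl h2))]
        linarith only [n3, n4, n5, n6]
      · rw [if_pos (hB1 (by linarith) (Or.inl h1)), if_pos (hW1 (Or.inl h2))]
        linarith only [n2, n3, n5, n6]
      · rw [if_pos (hB2 hac0 (Or.inl h1)), if_pos (hW1 (Or.inl h2))]
        linarith only [n1, n3, n5, n6]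
  by_cases hR0 : T ≤ c - a
  · rw [if_pos (hB2 hac0 (Or.inr (Or.inr (by linarith)))), if_pos (hW2 (Or.inr (Or.inr hR0)))]; linarith only [n1, n2, n3, n4, n5, n6]
  push Not at hR0
  by_cases hRX : T ≤ b + c ∨ T ≤ c - b
  · rw [if_pos (hB2 hac0 (Or.inr (Or.inr (by rcases hRX with h | h <;> linarith))))]
    rcases hRX with h | h
    · rw [if_pos (hW1 (Or.inr (Or.inr h)))]; linarith only [n1, n2, n3, n4, n5, n6]
    · rw [if_pos (hB3 hbltc (Or.inr (Or.inr h)))]; linarith only [n1, n2, n3, n4, n5, n6]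
  push Not at hRX
  obtain ⟨hbc, hcb⟩ := hRX
  have hTabs : c + |b| < T := by
    rcases le_or_gt 0 b with hb | hb
    · rw [abs_of_nonneg hb]; linarith only [hbc]
    · rw [abs_of_neg hb]; linarith only [hcb]
  have hz₁ : 0 < z₁ := by
    by_contra hz; push Not at hz
    have := flat_depth_le hn hs hba hab hu₁ hz; linarith only [this, hd₁, hTabs]
  have hz₂ : 0 < z₂ := by
    by_contra hz; push Not at hz
    have := flat_depth_le hn hs hba hab hu₂ hz; linarith only [this, hd₂, hTabs]
  have hbabs : |b| ≤ c := abs_le.2 ⟨by linarith, by linarith⟩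
  have keyP : 1 < x₁ + z₁ → y₁ + z₁ ≤ 1 → z₁ - y₁ ≤ 1 → 1 < x₂ + z₂ → y₂ + z₂ ≤ 1 → z₂ - y₂ ≤ 1 →
      (2 : ℝ) ≤ (if PB1 then (1 : ℝ) else 0) + (if PB2 then (1 : ℝ) else 0) + (if PB3 then (1 : ℝ) else 0) + (if PW1 then (1 : ℝ) else 0) + (if PW2 then (1 : ℝ) else 0) + (if PW3 then (1 : ℝ) else 0) := by
    intro p1 q1 r1 p2 q2 r2
    rw [if_pos (hB2 hac0 (Or.inl p1))]
    have hx₁ := zone_one_le hu₁ p1 q1 r1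
    have hx₂ := zone_one_le hu₂ p2 q2 r2
    rcases lt_or_eq_of_le hab with hab0 | hab0
    · by_cases hb1 : 1 < x₁ + y₁ ∨ 1 < x₂ + y₂
      · rw [if_pos (hB1 hab0 (hb1.elim Or.inl fun h => Or.inr (Or.inl h)))]; linarith only [n1, n2, n3, n4, n5, n6]
      · push Not at hb1
        have hyy : 0 ≤ y₁ * y₂ := mul_nonneg_of_nonpos_of_nonpos (by linarith) (by linarith)
        have := zone_pair_gt_one hu₁ hu₂ p1 q1 r1 p2 q2 r2 hyy
        linarith only [this, h12]
    · -- level hex pair `b = −a`: a contact with `y ≥ 0` is at most as deep as `B₂`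
      have hb : b = -a := by linarith
      have hz1 : z₁ ≤ 1 := by linarith
      have hz2 : z₂ ≤ 1 := by linarith
      have c1 := depth_le_of_P (x := x₁) (by nlinarith) hz1 ha hac
      have c2 := depth_le_of_P (x := x₂) (by nlinarith) hz2 ha hac
      have hy₁ : y₁ < 0 := by
        by_contra h; push Not at h
        have e : a * x₁ + b * y₁ + c * z₁ ≤ a + c := by rw [hb]; linarith only [c1, mul_nonneg ha h]
        rw [hb, abs_neg, abs_of_nonneg ha] at hTabs; linarith only [hTabs, e, hd₁]
      have hy₂ : y₂ < 0 := by
        by_contra h; push Not at h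
        have e : a * x₂ + b * y₂ + c * z₂ ≤ a + c := by rw [hb]; linarith only [c2, mul_nonneg ha h]
        rw [hb, abs_neg, abs_of_nonneg ha] at hTabs; linarith only [hTabs, e, hd₂]
      have := zone_pair_gt_one hu₁ hu₂ p1 q1 r1 p2 q2 r2 (mul_pos_of_neg_of_neg hy₁ hy₂).le
      linarith only [this, h12]
  have keyQ : 1 < y₁ + z₁ → x₁ + z₁ ≤ 1 → z₁ - x₁ ≤ 1 → 1 < y₂ + z₂ → x₂ + z₂ ≤ 1 → z₂ - x₂ ≤ 1 →
      (2 : ℝ) ≤ (if PB1 then (1 : ℝ) else 0) + (if PB2 then (1 : ℝ) else 0) + (if PB3 then (1 : ℝ) else 0) + (if PW1 then (1 : ℝ) else 0) + (if PW2 then (1 : ℝ) else 0) + (if PW3 then (1 : ℝ) else 0) := by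
    intro p1 q1 r1 p2 q2 r2
    rw [if_pos (hW1 (Or.inl p1))]
    have hy₁ := zone_one_le (x := y₁) (y := x₁) (z := z₁) (by linarith) p1 q1 r1
    have hy₂ := zone_one_le (x := y₂) (y := x₂) (z := z₂) (by linarith) p2 q2 r2
    rcases lt_or_eq_of_le hab with hab0 | hab0
    · by_cases hb1 : 1 < x₁ + y₁ ∨ 1 < x₂ + y₂
      · rw [if_pos (hB1 hab0 (hb1.elim Or.inl fun h => Or.inr (Or.inl h)))]; linarith only [n1, n2, n3, n4, n5, n6]
      · push Not at hb1
        have hxx : 0 ≤ x₁ * x₂ := mul_nonneg_of_nonpos_of_nonpos (by linarith) (by linarith)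
        have := zone_pair_gt_one (x := y₁) (y := x₁) (z := z₁) (x' := y₂) (y' := x₂) (z' := z₂)
          (by linarith only [hu₁]) (by linarith only [hu₂]) p1 q1 r1 p2 q2 r2 hxx
        linarith only [this, h12]
    · have hb : b = -a := by linarith
      have := depth_le_of_Q_level (x := x₁) (z := z₁) ha hac hy₁ q1 r1
      rw [hb] at hd₁; linarith only [this, hd₁, hR0]
  rcases steep_cover hu₁ hz₁ with p1 | m1 | q1 | r1 <;>
    rcases steep_cover hu₂ hz₂ with p2 | m2 | q2 | r2
  · by_cases q1 : 1 < y₁ + z₁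
    · rw [if_pos (hB2 hac0 (Or.inl p1)), if_pos (hW1 (Or.inl q1))]; linarith only [n1, n2, n3, n4, n5, n6]
    by_cases r1 : 1 < z₁ - y₁
    · rw [if_pos (hB2 hac0 (Or.inl p1)), if_pos (hB3 hbltc (Or.inl r1))]; linarith only [n1, n2, n3, n4, n5, n6]
    by_cases q2 : 1 < y₂ + z₂
    · rw [if_pos (hB2 hac0 (Or.inl p1)), if_pos (hW1 (Or.inr (Or.inl q2)))]; linarith only [n1, n2, n3, n4, n5, n6]
    by_cases r2 : 1 < z₂ - y₂
    · rw [if_pos (hB2 hac0 (Or.inl p1)), if_pos (hB3 hbltc (Or.inr (Or.inl r2)))]; linarith only [n1, n2, n3, n4, n5, n6]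
    push Not at q1 r1 q2 r2
    exact keyP p1 q1 r1 p2 q2 r2
  · rw [if_pos (hB2 hac0 (Or.inl p1)), if_pos (hW2 (Or.inr (Or.inl m2)))]; linarith only [n1, n2, n3, n4, n5, n6]
  · rw [if_pos (hB2 hac0 (Or.inl p1)), if_pos (hW1 (Or.inr (Or.inl q2)))]; linarith only [n1, n2, n3, n4, n5, n6]
  · rw [if_pos (hB2 hac0 (Or.inl p1)), if_pos (hB3 hbltc (Or.inr (Or.inl r2)))]; linarith only [n1, n2, n3, n4, n5, n6]
  · rw [if_pos (hW2 (Or.inl m1)), if_pos (hB2 hac0 (Or.inr (Or.inl p2)))]; linarith only [n1, n2, n3, n4, n5, n6]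
  · by_cases q1 : 1 < y₁ + z₁
    · rw [if_pos (hW2 (Or.inl m1)), if_pos (hW1 (Or.inl q1))]; linarith only [n1, n2, n3, n4, n5, n6]
    by_cases r1 : 1 < z₁ - y₁
    · rw [if_pos (hW2 (Or.inl m1)), if_pos (hB3 hbltc (Or.inl r1))]; linarith only [n1, n2, n3, n4, n5, n6]
    push Not at q1 r1
    have hx₁ := zone_one_le (x := -x₁) (y := y₁) (z := z₁) (by nlinarith) (by linarith) q1 r1
    have := depth_le_of_M (b := b) ha hbabs (by linarith only [hx₁] : x₁ ≤ -1) q1 r1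
    linarith only [this, hd₁, hR0]
  · rw [if_pos (hW2 (Or.inl m1)), if_pos (hW1 (Or.inr (Or.inl q2)))]; linarith only [n1, n2, n3, n4, n5, n6]
  · rw [if_pos (hW2 (Or.inl m1)), if_pos (hB3 hbltc (Or.inr (Or.inl r2)))]; linarith only [n1, n2, n3, n4, n5, n6]
  · rw [if_pos (hW1 (Or.inl q1)), if_pos (hB2 hac0 (Or.inr (Or.inl p2)))]; linarith only [n1, n2, n3, n4, n5, n6]
  · rw [if_pos (hW1 (Or.inl q1)), if_pos (hW2 (Or.inr (Or.inl m2)))]; linarith only [n1, n2, n3, n4, n5, n6]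
  · by_cases p1 : 1 < x₁ + z₁
    · rw [if_pos (hW1 (Or.inl q1)), if_pos (hB2 hac0 (Or.inl p1))]; linarith only [n1, n2, n3, n4, n5, n6]
    by_cases m1 : 1 < z₁ - x₁
    · rw [if_pos (hW1 (Or.inl q1)), if_pos (hW2 (Or.inl m1))]; linarith only [n1, n2, n3, n4, n5, n6]
    by_cases p2 : 1 < x₂ + z₂
    · rw [if_pos (hW1 (Or.inl q1)), if_pos (hB2 hac0 (Or.inr (Or.inl p2)))]; linarith only [n1, n2, n3, n4, n5, n6]
    by_cases m2 : 1 < z₂ - x₂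
    · rw [if_pos (hW1 (Or.inl q1)), if_pos (hW2 (Or.inr (Or.inl m2)))]; linarith only [n1, n2, n3, n4, n5, n6]
    push Not at p1 m1 p2 m2
    exact keyQ q1 p1 m1 q2 p2 m2
  · rw [if_pos (hW1 (Or.inl q1)), if_pos (hB3 hbltc (Or.inr (Or.inl r2)))]; linarith only [n1, n2, n3, n4, n5, n6]
  · rw [if_pos (hB3 hbltc (Or.inl r1)), if_pos (hB2 hac0 (Or.inr (Or.inl p2)))]; linarith only [n1, n2, n3, n4, n5, n6]
  · rw [if_pos (hB3 hbltc (Or.inl r1)), if_pos (hW2 (Or.inr (Or.inl m2)))]; linarith only [n1, n2, n3, n4, n5, n6]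
  · rw [if_pos (hB3 hbltc (Or.inl r1)), if_pos (hW1 (Or.inr (Or.inl q2)))]; linarith only [n1, n2, n3, n4, n5, n6]
  · by_cases p1 : 1 < x₁ + z₁
    · rw [if_pos (hB3 hbltc (Or.inl r1)), if_pos (hB2 hac0 (Or.inl p1))]; linarith only [n1, n2, n3, n4, n5, n6]
    by_cases m1 : 1 < z₁ - x₁
    · rw [if_pos (hB3 hbltc (Or.inl r1)), if_pos (hW2 (Or.inl m1))]; linarith only [n1, n2, n3, n4, n5, n6]
    push Not at p1 m1
    have := depth_le_of_B3zone hn hs hba hab hu₁ r1 p1 m1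
    linarith only [this, hd₁, hTabs]

end Summit.Ventures.Crystal3D.Theorems
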